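import Summits.CriticalPhenomena.PercolationContinuityZ3.Theorems.PercNearOneGluingNoHeavyLowerTailKnQuestion8CoefficientwiseCoreClassKernelMixFull
import HarnessLib

/-!
# The cube lemma and the DOUBLE-ROOT one-sided form (the `RR` piece of the hat / 2-sum rule)

Support file (`--supports stmt-CriticalPhenomena-4575`, closed), prover `prim-cplus-coupling` (gen 37).  No definitions, no notations, no named facts,
no sorries; standard axioms.  Memo `prim-cplus-coupling/A5-COUPLING-gen37.md` §1–§2.

Setting: middle graph `E`, two ROOTS `u, v` and an observer/terminal `b`; `R_x = C_x(ω)`, `B_x = C_x(E∖ω)`; `P = R_u ∪ R_v`, `Q = B_b`,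
`S = R_u ∪ R_v ∪ R_b`.  The DOUBLE-ROOT form (gen 36 memo §5.1, the `RR` class of the hat `a ~ u, v` glued onto `E`):
  `DR(E; u, v; b):  Σ_{ω ⊆ E} h(S)k(S) + Σ_{ω : b ∉ R_u ∪ R_v} (hᵃ(P) − hᵇ(Q))(kᵃ(P) − kᵇ(Q)) ≥ 0`
for monotone `h, k` and monotone levels `0 ≤ hᵃ, hᵇ ≤ h`, `0 ≤ kᵃ, kᵇ ≤ k` (the glued set `A ∪ ·` of the hat is absorbed into `h, k, hᵃ, kᵃ`).
* `Coefficientwise.cube_upset_transfer` — THE CUBE LEMMA: on `2^E` with `ω̄ = E ∖ ω`, for every UP-SET `𝒱` and increasing `0 ≤ a, p ≤ A`, `0 ≤ c, q ≤ C`: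
  `Σ_{ω ∈ 𝒱} [A(ω)C(ω) + (a(ω) − p(ω̄))(c(ω) − q(ω̄))] ≥ 0` (two two-colouring Harris inequalities with `F = a·1_𝒱`, then pointwise
  `AC + ac − aq − cp ≥ (A − a)(C − c)`).  With `𝒱 = ⊤` it is the transfer mechanism of gens 31–36; the restriction to an arbitrary increasing event is
  what the contact cells of the hat need (INCREASING-EVENT TRANSFER, memo §2: proved for trees and cycles, census-clean in general).
* `Coefficientwise.doubleRoot_contact_transfer` — the CONTACT REGION `{b ∉ P} ∩ {u ∈ Q ∨ v ∈ Q}` of `DR` is paid by ONE copy of the supply on its colour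
  swap `{b ∉ B_u ∪ B_v} ∩ {u ∈ R_b ∨ v ∈ R_b}` — for EVERY graph (Harris transfer with `F = hᵃ(P)`, `G = kᵇ(R_b)·1_swap`; pointwise
  `(h(S) − hᵇ(R_b))(k(S) − kᵇ(R_b)) ≥ 0`).
* `Coefficientwise.coreClass_doubleRoot_of_properDom` — **THEOREM DR-C**: a double-root domination map on the wall part
  `T′ = {b ∉ P, u ∉ Q, v ∉ Q}` (injective, `ψω ⊆ E`, `P ∪ Q ⊆ S(ψω)`) whose image avoids `{u ∈ R_b} ∪ {v ∈ R_b}` gives `DR(E; u, v; b)` at all levels.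
  The double-root `R_A` (flip the edges away from `P`) is such a map whenever `(E; {u,v}, b)` is pocket-free, in particular for every `E` whose vertices
  other than `u, v, b` lie on at most two edges (cycles through `u, b, v`, bundles) — memo §1.3; Lean in the companion file.
[cite: KozmaNitzan2024, Questions 8–9 (§5.5 p. 36) (context: the Question-8 pocket covariance programme)]
-/

namespace Summit.CriticalPhenomena.PercolationContinuityZ3.Theorems

open Finset Literature.Probability.Percolation

namespace Coefficientwise

variable {ι V : Type*}

/-- **The cube lemma.**  On the powerset of `E` with complement `ω̄ = E ∖ ω`: for an up-closed predicate `𝒱` and monotone functions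
`0 ≤ a, p ≤ A`, `0 ≤ c, q ≤ C` (pointwise), `0 ≤ Σ_{ω ⊆ E, ω ∈ 𝒱} [A(ω)C(ω) + (a(ω) − p(E∖ω))(c(ω) − q(E∖ω))]`.
[cite: KozmaNitzan2024, Questions 8–9 (§5.5 p. 36) (context; mechanism: Harris 1960)] -/
theorem cube_upset_transfer [DecidableEq ι] (E : Finset ι) (𝒱 : Finset ι → Prop) [DecidablePred 𝒱]
    (hV : ∀ ⦃s t : Finset ι⦄, s ⊆ t → 𝒱 s → 𝒱 t)
    (a p A c q C : Finset ι → ℝ) (ma : Monotone a) (mp : Monotone p) (mc : Monotone c) (mq : Monotone q)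
    (a0 : ∀ s, 0 ≤ a s) (aA : ∀ s, a s ≤ A s) (p0 : ∀ s, 0 ≤ p s) (pA : ∀ s, p s ≤ A s)
    (c0 : ∀ s, 0 ≤ c s) (cC : ∀ s, c s ≤ C s) (q0 : ∀ s, 0 ≤ q s) (qC : ∀ s, q s ≤ C s) :
    0 ≤ ∑ ω ∈ E.powerset, (if 𝒱 ω then A ω * C ω + (a ω - p (E \ ω)) * (c ω - q (E \ ω)) else 0) := by
  set F₁ : Finset ι → ℝ := fun ω => if 𝒱 ω then a ω else 0 with hF₁
  set F₂ : Finset ι → ℝ := fun ω => if 𝒱 ω then c ω else 0 with hF₂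
  have mF₁ : Monotone F₁ := by
    intro s t hst
    simp only [hF₁]
    by_cases hs : 𝒱 s
    · rw [if_pos hs, if_pos (hV hst hs)]; exact ma hst
    · rw [if_neg hs]
      by_cases ht : 𝒱 t
      · rw [if_pos ht]; exact a0 t
      · rw [if_neg ht]
  have mF₂ : Monotone F₂ := by
    intro s t hst
    simp only [hF₂]
    by_cases hs : 𝒱 s
    · rw [if_pos hs, if_pos (hV hst hs)]; exact mc hst
    · rw [if_neg hs]
      by_cases ht : 𝒱 t
      · rw [if_pos ht]; exact c0 t
      · rw [if_neg ht]
  have h1 := sum_mul_sdiff_le_sum_mul E F₁ q mF₁ mq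
  have h2 := sum_mul_sdiff_le_sum_mul E F₂ p mF₂ mp
  have key : ∀ ω ∈ E.powerset, (if 𝒱 ω then A ω * C ω + (a ω - p (E \ ω)) * (c ω - q (E \ ω)) else 0)
      = (if 𝒱 ω then A ω * C ω + a ω * c ω + p (E \ ω) * q (E \ ω) - a ω * q ω - c ω * p ω else 0)
        + (F₁ ω * q ω - F₁ ω * q (E \ ω)) + (F₂ ω * p ω - F₂ ω * p (E \ ω)) := by
    intro ω _
    simp only [hF₁, hF₂]
    by_cases hv : 𝒱 ω
    · simp only [if_pos hv]; ring
    · simp only [if_neg hv]; ring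
  rw [Finset.sum_congr rfl key, Finset.sum_add_distrib, Finset.sum_add_distrib, Finset.sum_sub_distrib, Finset.sum_sub_distrib]
  have pt : 0 ≤ ∑ ω ∈ E.powerset, (if 𝒱 ω then A ω * C ω + a ω * c ω + p (E \ ω) * q (E \ ω) - a ω * q ω - c ω * p ω else 0) := by
    refine Finset.sum_nonneg fun ω _ => ?_
    by_cases hv : 𝒱 ω
    · rw [if_pos hv]
      have e1 : 0 ≤ a ω * (C ω - q ω) := mul_nonneg (a0 ω) (sub_nonneg.mpr (qC ω))
      have e2 : 0 ≤ c ω * (A ω - p ω) := mul_nonneg (c0 ω) (sub_nonneg.mpr (pA ω))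
      have e3 : 0 ≤ (A ω - a ω) * (C ω - c ω) := mul_nonneg (sub_nonneg.mpr (aA ω)) (sub_nonneg.mpr (cC ω))
      have e4 : 0 ≤ p (E \ ω) * q (E \ ω) := mul_nonneg (p0 _) (q0 _)
      nlinarith [e1, e2, e3, e4]
    · rw [if_neg hv]
  linarith

open Classical in
/-- **The contact region of the double-root form is paid by its colour swap (any graph).**  Edge set `E`, roots `u, v`, observer `b`; monotone `h, k`,
monotone levels `0 ≤ hᵃ ≤ h`, `0 ≤ hᵇ ≤ h`, `0 ≤ kᵃ ≤ k`, `0 ≤ kᵇ ≤ k`.  With `P = C_u ω ∪ C_v ω`, `Q = C_b(E∖ω)`, `S = C_u ω ∪ C_v ω ∪ C_b ω`: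
`0 ≤ Σ_{ω : b ∉ C_u(E∖ω) ∪ C_v(E∖ω), u ∈ C_b ω ∨ v ∈ C_b ω} h(S)k(S) + Σ_{ω : b ∉ P, u ∈ Q ∨ v ∈ Q} (hᵃ(P) − hᵇ(Q))(kᵃ(P) − kᵇ(Q))`.
[cite: KozmaNitzan2024, Questions 8–9 (§5.5 p. 36) (context)] -/
theorem doubleRoot_contact_transfer (ends : ι → Sym2 V) (E : Finset ι) (u v b : V) (h k ha hb ka kb : Set V → ℝ)
    (hh : Monotone h) (hk : Monotone k) (mha : Monotone ha) (mka : Monotone ka) (mhb : Monotone hb) (mkb : Monotone kb)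
    (ha0 : ∀ X, 0 ≤ ha X) (hah : ∀ X, ha X ≤ h X) (hb0 : ∀ X, 0 ≤ hb X) (hbh : ∀ X, hb X ≤ h X)
    (ka0 : ∀ X, 0 ≤ ka X) (kak : ∀ X, ka X ≤ k X) (kb0 : ∀ X, 0 ≤ kb X) (kbk : ∀ X, kb X ≤ k X) :
    0 ≤ (∑ ω ∈ E.powerset, if (b ∉ openCluster (ends '' (↑(E \ ω) : Set ι)) u ∧ b ∉ openCluster (ends '' (↑(E \ ω) : Set ι)) v) ∧
          (u ∈ openCluster (ends '' (↑ω : Set ι)) b ∨ v ∈ openCluster (ends '' (↑ω : Set ι)) b) then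
          h (openCluster (ends '' (↑ω : Set ι)) u ∪ openCluster (ends '' (↑ω : Set ι)) v ∪ openCluster (ends '' (↑ω : Set ι)) b) *
            k (openCluster (ends '' (↑ω : Set ι)) u ∪ openCluster (ends '' (↑ω : Set ι)) v ∪ openCluster (ends '' (↑ω : Set ι)) b) else 0)
      + ∑ ω ∈ E.powerset, if (b ∉ openCluster (ends '' (↑ω : Set ι)) u ∧ b ∉ openCluster (ends '' (↑ω : Set ι)) v) ∧
          (u ∈ openCluster (ends '' (↑(E \ ω) : Set ι)) b ∨ v ∈ openCluster (ends '' (↑(E \ ω) : Set ι)) b) then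
          (ha (openCluster (ends '' (↑ω : Set ι)) u ∪ openCluster (ends '' (↑ω : Set ι)) v) - hb (openCluster (ends '' (↑(E \ ω) : Set ι)) b)) *
            (ka (openCluster (ends '' (↑ω : Set ι)) u ∪ openCluster (ends '' (↑ω : Set ι)) v) - kb (openCluster (ends '' (↑(E \ ω) : Set ι)) b))
          else 0 := by
  set C : Finset ι → V → Set V := fun ω x => openCluster (ends '' (↑ω : Set ι)) x with hC
  -- swapped cell `Z ω` (supply) and contact region `D ω`
  set Z : Finset ι → Prop := fun ω => (b ∉ C (E \ ω) u ∧ b ∉ C (E \ ω) v) ∧ (u ∈ C ω b ∨ v ∈ C ω b) with hZ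
  set D : Finset ι → Prop := fun ω => (b ∉ C ω u ∧ b ∉ C ω v) ∧ (u ∈ C (E \ ω) b ∨ v ∈ C (E \ ω) b) with hD
  change 0 ≤ (∑ ω ∈ E.powerset, if Z ω then h (C ω u ∪ C ω v ∪ C ω b) * k (C ω u ∪ C ω v ∪ C ω b) else 0)
    + ∑ ω ∈ E.powerset, if D ω then (ha (C ω u ∪ C ω v) - hb (C (E \ ω) b)) * (ka (C ω u ∪ C ω v) - kb (C (E \ ω) b)) else 0
  have hCmono : ∀ {ω ω' : Finset ι} (x : V), ω ⊆ ω' → C ω x ⊆ C ω' x := fun x hle => openCluster_image_mono ends hle x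
  have hDZ : ∀ ω, ω ⊆ E → (D ω ↔ Z (E \ ω)) := by
    intro ω hω
    simp only [hD, hZ, Finset.sdiff_sdiff_eq_self hω]
  -- `Z` is an up-set (as a predicate on all finsets)
  have hZmono : ∀ {ω ω' : Finset ι}, ω ⊆ ω' → Z ω → Z ω' := by
    intro ω ω' hle hz
    simp only [hZ] at hz ⊢
    refine ⟨⟨fun hx => hz.1.1 (hCmono u (Finset.sdiff_subset_sdiff (le_refl E) hle) hx),
      fun hx => hz.1.2 (hCmono v (Finset.sdiff_subset_sdiff (le_refl E) hle) hx)⟩, ?_⟩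
    rcases hz.2 with hx | hx
    · exact Or.inl (hCmono b hle hx)
    · exact Or.inr (hCmono b hle hx)
  -- on `Z`, `C_b ω ⊆ S`; the pointwise inequality there
  have hRS : ∀ ω, C ω b ⊆ C ω u ∪ C ω v ∪ C ω b := fun ω y hy => Or.inr hy
  have hPS : ∀ ω, C ω u ∪ C ω v ⊆ C ω u ∪ C ω v ∪ C ω b := fun ω y hy => Or.inl hy
  -- (1) the square `hᵇkᵇ(Q)` on `D` swaps onto `hᵇkᵇ(C_b ω)` on `Z`
  have sq : ∑ ω ∈ E.powerset, (if D ω then hb (C (E \ ω) b) * kb (C (E \ ω) b) else 0)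
      = ∑ ω ∈ E.powerset, (if Z ω then hb (C ω b) * kb (C ω b) else 0) := by
    rw [← sum_powerset_sdiff E (fun ω => if Z ω then hb (C ω b) * kb (C ω b) else 0)]
    refine Finset.sum_congr rfl fun ω hω => ?_
    have e := hDZ ω (Finset.mem_powerset.mp hω)
    by_cases h1 : D ω
    · rw [if_pos h1, if_pos (e.mp h1)]
    · rw [if_neg h1, if_neg (fun h2 => h1 (e.mpr h2))]
  -- (2) the cross terms by the two-colouring Harris inequality
  have cross1 : ∑ ω ∈ E.powerset, (if D ω then ha (C ω u ∪ C ω v) * kb (C (E \ ω) b) else 0)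
      ≤ ∑ ω ∈ E.powerset, (if Z ω then ha (C ω u ∪ C ω v) * kb (C ω b) else 0) := by
    set F : Finset ι → ℝ := fun ω => ha (C ω u ∪ C ω v) with hF
    set G : Finset ι → ℝ := fun ω => if Z ω then kb (C ω b) else 0 with hG
    have hFm : Monotone F := fun ω ω' hle => mha (Set.union_subset_union (hCmono u hle) (hCmono v hle))
    have hGm : Monotone G := by
      intro ω ω' hle
      simp only [hG]
      by_cases h1 : Z ω
      · rw [if_pos h1, if_pos (hZmono hle h1)]; exact mkb (hCmono b hle)
      · rw [if_neg h1]
        by_cases h2 : Z ω'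
        · rw [if_pos h2]; exact kb0 _
        · rw [if_neg h2]
    have key := sum_mul_sdiff_le_sum_mul E F G hFm hGm
    have lhs : ∑ ω ∈ E.powerset, F ω * G (E \ ω) = ∑ ω ∈ E.powerset, (if D ω then ha (C ω u ∪ C ω v) * kb (C (E \ ω) b) else 0) := by
      refine Finset.sum_congr rfl fun ω hω => ?_
      simp only [hF, hG]
      have e := hDZ ω (Finset.mem_powerset.mp hω)
      by_cases h1 : D ω
      · rw [if_pos h1, if_pos (e.mp h1)]
      · rw [if_neg h1, if_neg (fun h2 => h1 (e.mpr h2)), mul_zero]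
    have rhs : ∑ ω ∈ E.powerset, F ω * G ω = ∑ ω ∈ E.powerset, (if Z ω then ha (C ω u ∪ C ω v) * kb (C ω b) else 0) := by
      refine Finset.sum_congr rfl fun ω _ => ?_
      simp only [hF, hG]
      by_cases h1 : Z ω
      · rw [if_pos h1, if_pos h1]
      · rw [if_neg h1, if_neg h1, mul_zero]
    rw [lhs, rhs] at key
    exact key
  have cross2 : ∑ ω ∈ E.powerset, (if D ω then ka (C ω u ∪ C ω v) * hb (C (E \ ω) b) else 0)
      ≤ ∑ ω ∈ E.powerset, (if Z ω then ka (C ω u ∪ C ω v) * hb (C ω b) else 0) := by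
    set F : Finset ι → ℝ := fun ω => ka (C ω u ∪ C ω v) with hF
    set G : Finset ι → ℝ := fun ω => if Z ω then hb (C ω b) else 0 with hG
    have hFm : Monotone F := fun ω ω' hle => mka (Set.union_subset_union (hCmono u hle) (hCmono v hle))
    have hGm : Monotone G := by
      intro ω ω' hle
      simp only [hG]
      by_cases h1 : Z ω
      · rw [if_pos h1, if_pos (hZmono hle h1)]; exact mhb (hCmono b hle)
      · rw [if_neg h1]
        by_cases h2 : Z ω'
        · rw [if_pos h2]; exact hb0 _
        · rw [if_neg h2]
    have key := sum_mul_sdiff_le_sum_mul E F G hFm hGm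
    have lhs : ∑ ω ∈ E.powerset, F ω * G (E \ ω) = ∑ ω ∈ E.powerset, (if D ω then ka (C ω u ∪ C ω v) * hb (C (E \ ω) b) else 0) := by
      refine Finset.sum_congr rfl fun ω hω => ?_
      simp only [hF, hG]
      have e := hDZ ω (Finset.mem_powerset.mp hω)
      by_cases h1 : D ω
      · rw [if_pos h1, if_pos (e.mp h1)]
      · rw [if_neg h1, if_neg (fun h2 => h1 (e.mpr h2)), mul_zero]
    have rhs : ∑ ω ∈ E.powerset, F ω * G ω = ∑ ω ∈ E.powerset, (if Z ω then ka (C ω u ∪ C ω v) * hb (C ω b) else 0) := by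
      refine Finset.sum_congr rfl fun ω _ => ?_
      simp only [hF, hG]
      by_cases h1 : Z ω
      · rw [if_pos h1, if_pos h1]
      · rw [if_neg h1, if_neg h1, mul_zero]
    rw [lhs, rhs] at key
    exact key
  -- (3) termwise expansion on `D`, dropping the square `hᵃkᵃ(P) ≥ 0`
  have expand : (∑ ω ∈ E.powerset, (if D ω then hb (C (E \ ω) b) * kb (C (E \ ω) b) else 0))
      - (∑ ω ∈ E.powerset, (if D ω then ha (C ω u ∪ C ω v) * kb (C (E \ ω) b) else 0))
      - (∑ ω ∈ E.powerset, (if D ω then ka (C ω u ∪ C ω v) * hb (C (E \ ω) b) else 0))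
      ≤ ∑ ω ∈ E.powerset, (if D ω then (ha (C ω u ∪ C ω v) - hb (C (E \ ω) b)) * (ka (C ω u ∪ C ω v) - kb (C (E \ ω) b)) else 0) := by
    rw [← Finset.sum_sub_distrib, ← Finset.sum_sub_distrib]
    refine Finset.sum_le_sum fun ω _ => ?_
    by_cases h1 : D ω
    · rw [if_pos h1, if_pos h1, if_pos h1, if_pos h1]
      nlinarith [mul_nonneg (ha0 (C ω u ∪ C ω v)) (ka0 (C ω u ∪ C ω v))]
    · rw [if_neg h1, if_neg h1, if_neg h1, if_neg h1]; linarith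
  -- (4) the pointwise inequality on `Z`
  have final : 0 ≤ ∑ ω ∈ E.powerset, ((if Z ω then h (C ω u ∪ C ω v ∪ C ω b) * k (C ω u ∪ C ω v ∪ C ω b) else 0)
      + (if Z ω then hb (C ω b) * kb (C ω b) else 0)
      - (if Z ω then ha (C ω u ∪ C ω v) * kb (C ω b) else 0) - (if Z ω then ka (C ω u ∪ C ω v) * hb (C ω b) else 0)) := by
    refine Finset.sum_nonneg fun ω _ => ?_
    by_cases h1 : Z ω
    · rw [if_pos h1, if_pos h1, if_pos h1, if_pos h1]
      have := kernelMix_pointwise (w := h (C ω u ∪ C ω v ∪ C ω b)) (u := hb (C ω b)) (v := ha (C ω u ∪ C ω v))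
        (w' := k (C ω u ∪ C ω v ∪ C ω b)) (u' := kb (C ω b)) (v' := ka (C ω u ∪ C ω v))
        (hb0 _) (le_trans (hbh _) (hh (hRS ω))) (le_trans (hah _) (hh (hPS ω)))
        (kb0 _) (le_trans (kbk _) (hk (hRS ω))) (le_trans (kak _) (hk (hPS ω)))
      linarith
    · rw [if_neg h1, if_neg h1, if_neg h1, if_neg h1]; linarith
  rw [Finset.sum_sub_distrib, Finset.sum_sub_distrib, Finset.sum_add_distrib] at final
  linarith [sq, cross1, cross2, expand, final]

open Classical in
/-- **THEOREM DR-C (the double-root form from a proper double-root domination map).**  Edge set `E`, roots `u, v`, observer `b`; monotone `h, k` and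
monotone levels `0 ≤ hᵃ, hᵇ ≤ h`, `0 ≤ kᵃ, kᵇ ≤ k`.  Let `ψ` be defined on the wall part `T′ = {ω ⊆ E : b ∉ C_u ω ∪ C_v ω, u, v ∉ C_b(E∖ω)}` with
`ψω ⊆ E`, `C_u ω ∪ C_v ω ∪ C_b(E∖ω) ⊆ C_u(ψω) ∪ C_v(ψω) ∪ C_b(ψω)`, injective on `T′`, and `u, v ∉ C_b(ψω)` (image off `{u ∈ R_b} ∪ {v ∈ R_b}`).  Then
`0 ≤ Σ_{ω ⊆ E} h(S)k(S) + Σ_{ω : b ∉ C_u ω, b ∉ C_v ω} (hᵃ(C_u ω ∪ C_v ω) − hᵇ(C_b(E∖ω)))(kᵃ(C_u ω ∪ C_v ω) − kᵇ(C_b(E∖ω)))`, `S = C_u ω ∪ C_v ω ∪ C_b ω`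
— the DOUBLE-ROOT one-sided form `DR(E; u, v; b)` (the `RR` piece of the hat 2-sum).  Wall part: the map; contact region: `doubleRoot_contact_transfer`.
[cite: KozmaNitzan2024, Questions 8–9 (§5.5 p. 36) (context)] -/
theorem coreClass_doubleRoot_of_properDom (ends : ι → Sym2 V) (E : Finset ι) (u v b : V) (h k ha hb ka kb : Set V → ℝ)
    (hh : Monotone h) (hk : Monotone k) (mha : Monotone ha) (mhb : Monotone hb) (mka : Monotone ka) (mkb : Monotone kb)
    (ha0 : ∀ X, 0 ≤ ha X) (hah : ∀ X, ha X ≤ h X) (hb0 : ∀ X, 0 ≤ hb X) (hbh : ∀ X, hb X ≤ h X)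
    (ka0 : ∀ X, 0 ≤ ka X) (kak : ∀ X, ka X ≤ k X) (kb0 : ∀ X, 0 ≤ kb X) (kbk : ∀ X, kb X ≤ k X)
    (ψ : Finset ι → Finset ι)
    (hψE : ∀ ω, ω ⊆ E → b ∉ openCluster (ends '' (↑ω : Set ι)) u → b ∉ openCluster (ends '' (↑ω : Set ι)) v →
      u ∉ openCluster (ends '' (↑(E \ ω) : Set ι)) b → v ∉ openCluster (ends '' (↑(E \ ω) : Set ι)) b → ψ ω ⊆ E)
    (hψcov : ∀ ω, ω ⊆ E → b ∉ openCluster (ends '' (↑ω : Set ι)) u → b ∉ openCluster (ends '' (↑ω : Set ι)) v →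
      u ∉ openCluster (ends '' (↑(E \ ω) : Set ι)) b → v ∉ openCluster (ends '' (↑(E \ ω) : Set ι)) b →
      openCluster (ends '' (↑ω : Set ι)) u ∪ openCluster (ends '' (↑ω : Set ι)) v ∪ openCluster (ends '' (↑(E \ ω) : Set ι)) b ⊆
        openCluster (ends '' (↑(ψ ω) : Set ι)) u ∪ openCluster (ends '' (↑(ψ ω) : Set ι)) v ∪ openCluster (ends '' (↑(ψ ω) : Set ι)) b)
    (hψinj : ∀ ω₁ ω₂, ω₁ ⊆ E → b ∉ openCluster (ends '' (↑ω₁ : Set ι)) u → b ∉ openCluster (ends '' (↑ω₁ : Set ι)) v →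
      u ∉ openCluster (ends '' (↑(E \ ω₁) : Set ι)) b → v ∉ openCluster (ends '' (↑(E \ ω₁) : Set ι)) b →
      ω₂ ⊆ E → b ∉ openCluster (ends '' (↑ω₂ : Set ι)) u → b ∉ openCluster (ends '' (↑ω₂ : Set ι)) v →
      u ∉ openCluster (ends '' (↑(E \ ω₂) : Set ι)) b → v ∉ openCluster (ends '' (↑(E \ ω₂) : Set ι)) b → ψ ω₁ = ψ ω₂ → ω₁ = ω₂)
    (hψprop : ∀ ω, ω ⊆ E → b ∉ openCluster (ends '' (↑ω : Set ι)) u → b ∉ openCluster (ends '' (↑ω : Set ι)) v →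
      u ∉ openCluster (ends '' (↑(E \ ω) : Set ι)) b → v ∉ openCluster (ends '' (↑(E \ ω) : Set ι)) b →
      u ∉ openCluster (ends '' (↑(ψ ω) : Set ι)) b ∧ v ∉ openCluster (ends '' (↑(ψ ω) : Set ι)) b) :
    0 ≤ (∑ ω ∈ E.powerset,
        h (openCluster (ends '' (↑ω : Set ι)) u ∪ openCluster (ends '' (↑ω : Set ι)) v ∪ openCluster (ends '' (↑ω : Set ι)) b) *
          k (openCluster (ends '' (↑ω : Set ι)) u ∪ openCluster (ends '' (↑ω : Set ι)) v ∪ openCluster (ends '' (↑ω : Set ι)) b))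
      + ∑ ω ∈ E.powerset.filter (fun ω : Finset ι => b ∉ openCluster (ends '' (↑ω : Set ι)) u ∧ b ∉ openCluster (ends '' (↑ω : Set ι)) v),
        (ha (openCluster (ends '' (↑ω : Set ι)) u ∪ openCluster (ends '' (↑ω : Set ι)) v) - hb (openCluster (ends '' (↑(E \ ω) : Set ι)) b)) *
          (ka (openCluster (ends '' (↑ω : Set ι)) u ∪ openCluster (ends '' (↑ω : Set ι)) v) - kb (openCluster (ends '' (↑(E \ ω) : Set ι)) b)) := by
  set C : Finset ι → V → Set V := fun ω x => openCluster (ends '' (↑ω : Set ι)) x with hC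
  set S : Finset ι → Set V := fun ω => C ω u ∪ C ω v ∪ C ω b with hS
  change 0 ≤ (∑ ω ∈ E.powerset, h (S ω) * k (S ω))
    + ∑ ω ∈ E.powerset.filter (fun ω => b ∉ C ω u ∧ b ∉ C ω v), (ha (C ω u ∪ C ω v) - hb (C (E \ ω) b)) * (ka (C ω u ∪ C ω v) - kb (C (E \ ω) b))
  have hh0 : ∀ X, 0 ≤ h X := fun X => le_trans (ha0 X) (hah X)
  have hk0 : ∀ X, 0 ≤ k X := fun X => le_trans (ka0 X) (kak X)
  have hY0 : ∀ ω, 0 ≤ h (S ω) * k (S ω) := fun ω => mul_nonneg (hh0 _) (hk0 _)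
  -- index predicates: wall part `T`, contact region `D`, swapped contact region `Z`, the red double route `R₂`
  set T : Finset ι → Prop := fun ω => (b ∉ C ω u ∧ b ∉ C ω v) ∧ (u ∉ C (E \ ω) b ∧ v ∉ C (E \ ω) b) with hT
  set D : Finset ι → Prop := fun ω => (b ∉ C ω u ∧ b ∉ C ω v) ∧ (u ∈ C (E \ ω) b ∨ v ∈ C (E \ ω) b) with hD
  set Z : Finset ι → Prop := fun ω => (b ∉ C (E \ ω) u ∧ b ∉ C (E \ ω) v) ∧ (u ∈ C ω b ∨ v ∈ C ω b) with hZ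
  set R₂ : Finset ι → Prop := fun ω => u ∈ C ω b ∨ v ∈ C ω b with hR₂
  -- (1) the anti-sum splits into wall part and contact region
  have hsplit_anti : ∑ ω ∈ E.powerset.filter (fun ω => b ∉ C ω u ∧ b ∉ C ω v),
        (ha (C ω u ∪ C ω v) - hb (C (E \ ω) b)) * (ka (C ω u ∪ C ω v) - kb (C (E \ ω) b))
      = (∑ ω ∈ E.powerset, if T ω then (ha (C ω u ∪ C ω v) - hb (C (E \ ω) b)) * (ka (C ω u ∪ C ω v) - kb (C (E \ ω) b)) else 0)
        + ∑ ω ∈ E.powerset, if D ω then (ha (C ω u ∪ C ω v) - hb (C (E \ ω) b)) * (ka (C ω u ∪ C ω v) - kb (C (E \ ω) b)) else 0 := by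
    rw [Finset.sum_filter, ← Finset.sum_add_distrib]
    refine Finset.sum_congr rfl fun ω _ => ?_
    by_cases h1 : b ∉ C ω u ∧ b ∉ C ω v
    · by_cases h2 : u ∉ C (E \ ω) b ∧ v ∉ C (E \ ω) b
      · have hT1 : T ω := ⟨h1, h2⟩
        have hD1 : ¬ D ω := fun hd => hd.2.elim (fun hx => h2.1 hx) (fun hx => h2.2 hx)
        rw [if_pos h1, if_pos hT1, if_neg hD1, add_zero]
      · have hT1 : ¬ T ω := fun ht => h2 ht.2
        have hD1 : D ω := ⟨h1, by
          by_cases hu : u ∈ C (E \ ω) b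
          · exact Or.inl hu
          · exact Or.inr (by_contra fun hv => h2 ⟨hu, hv⟩)⟩
        rw [if_pos h1, if_neg hT1, if_pos hD1, zero_add]
    · have hT1 : ¬ T ω := fun ht => h1 ht.1
      have hD1 : ¬ D ω := fun hd => h1 hd.1
      rw [if_neg h1, if_neg hT1, if_neg hD1, add_zero]
  -- (2) the supply dominates its parts off `R₂` and on `Z ⊆ R₂`
  have hsplit_sup : (∑ ω ∈ E.powerset, if ¬ R₂ ω then h (S ω) * k (S ω) else 0)
      + (∑ ω ∈ E.powerset, if Z ω then h (S ω) * k (S ω) else 0) ≤ ∑ ω ∈ E.powerset, h (S ω) * k (S ω) := by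
    rw [← Finset.sum_add_distrib]
    refine Finset.sum_le_sum fun ω _ => ?_
    by_cases h1 : R₂ ω
    · rw [if_neg (not_not.mpr h1)]
      by_cases h2 : Z ω
      · rw [if_pos h2]; linarith
      · rw [if_neg h2]; linarith [hY0 ω]
    · have h2 : ¬ Z ω := fun hz => h1 hz.2
      rw [if_pos h1, if_neg h2]; linarith
  -- (3) the wall part: termwise against the supply at `ψ ω`, then injectivity into the colourings off `R₂`
  have step : 0 ≤ ∑ ω ∈ E.powerset, ((if T ω then (ha (C ω u ∪ C ω v) - hb (C (E \ ω) b)) * (ka (C ω u ∪ C ω v) - kb (C (E \ ω) b)) else 0)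
      + (if T ω then h (S (ψ ω)) * k (S (ψ ω)) else 0)) := by
    refine Finset.sum_nonneg fun ω hω => ?_
    by_cases h1 : T ω
    · rw [if_pos h1, if_pos h1]
      have hωE := Finset.mem_powerset.mp hω
      have hcov := hψcov ω hωE h1.1.1 h1.1.2 h1.2.1 h1.2.2
      have hPS : C ω u ∪ C ω v ⊆ S (ψ ω) := fun y hy => hcov (Or.inl hy)
      have hQS : C (E \ ω) b ⊆ S (ψ ω) := fun y hy => hcov (Or.inr hy)
      have := mul_add_sub_mul_sub_nonneg (A := h (S (ψ ω))) (B := k (S (ψ ω)))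
        (α := ha (C ω u ∪ C ω v)) (β := hb (C (E \ ω) b)) (γ := ka (C ω u ∪ C ω v)) (δ := kb (C (E \ ω) b))
        (ha0 _) (le_trans (hah _) (hh hPS)) (hb0 _) (le_trans (hbh _) (hh hQS))
        (ka0 _) (le_trans (kak _) (hk hPS)) (kb0 _) (le_trans (kbk _) (hk hQS))
      linarith
    · rw [if_neg h1, if_neg h1]; linarith
  have lower : ∑ ω ∈ E.powerset, (if T ω then h (S (ψ ω)) * k (S (ψ ω)) else 0)
      ≤ ∑ ω ∈ E.powerset, (if ¬ R₂ ω then h (S ω) * k (S ω) else 0) := by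
    rw [← Finset.sum_filter, ← Finset.sum_filter]
    have hTmem : ∀ {ω}, ω ∈ E.powerset.filter (fun ω => T ω) ↔ ω ⊆ E ∧ T ω := fun {ω} => by
      rw [Finset.mem_filter, Finset.mem_powerset]
    have hinj : ∀ ω₁ ∈ E.powerset.filter (fun ω => T ω), ∀ ω₂ ∈ E.powerset.filter (fun ω => T ω), ψ ω₁ = ψ ω₂ → ω₁ = ω₂ := by
      intro ω₁ h₁ ω₂ h₂ he
      obtain ⟨s1, t1⟩ := hTmem.mp h₁
      obtain ⟨s2, t2⟩ := hTmem.mp h₂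
      exact hψinj ω₁ ω₂ s1 t1.1.1 t1.1.2 t1.2.1 t1.2.2 s2 t2.1.1 t2.1.2 t2.2.1 t2.2.2 he
    have e1 : ∑ ω ∈ E.powerset.filter (fun ω => T ω), h (S (ψ ω)) * k (S (ψ ω))
        = ∑ ω' ∈ (E.powerset.filter (fun ω => T ω)).image ψ, h (S ω') * k (S ω') :=
      (Finset.sum_image (f := fun ω' => h (S ω') * k (S ω')) hinj).symm
    rw [e1]
    refine Finset.sum_le_sum_of_subset_of_nonneg ?_ (fun ω _ _ => hY0 ω)
    intro ω' hω'
    rw [Finset.mem_image] at hω'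
    obtain ⟨ω, hω, rfl⟩ := hω'
    obtain ⟨s1, t1⟩ := hTmem.mp hω
    rw [Finset.mem_filter, Finset.mem_powerset]
    refine ⟨hψE ω s1 t1.1.1 t1.1.2 t1.2.1 t1.2.2, ?_⟩
    have hp := hψprop ω s1 t1.1.1 t1.1.2 t1.2.1 t1.2.2
    simp only [hR₂, not_or]
    exact hp
  -- (4) the contact region
  have hcontact := doubleRoot_contact_transfer ends E u v b h k ha hb ka kb hh hk mha mka mhb mkb ha0 hah hb0 hbh ka0 kak kb0 kbk
  change 0 ≤ (∑ ω ∈ E.powerset, if Z ω then h (S ω) * k (S ω) else 0)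
    + ∑ ω ∈ E.powerset, if D ω then (ha (C ω u ∪ C ω v) - hb (C (E \ ω) b)) * (ka (C ω u ∪ C ω v) - kb (C (E \ ω) b)) else 0 at hcontact
  rw [Finset.sum_add_distrib] at step
  rw [hsplit_anti]
  linarith [hsplit_sup, step, lower, hcontact]

end Coefficientwise

end Summit.CriticalPhenomena.PercolationContinuityZ3.Theorems
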